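import Literature.AlgebraicGeometry.ShimuraVarieties.UnitaryShimuraCurveDescendedTower
import Literature.AlgebraicGeometry.ShimuraVarieties.UnitaryShimuraCurveDescendedPoints
import Literature.AlgebraicGeometry.ShimuraVarieties.UnitaryShimuraCurveDescendedPieces
import Literature.AlgebraicGeometry.ShimuraVarieties.UnitaryShimuraCurveDescendedCover
import Literature.AlgebraicGeometry.ShimuraVarieties.UnitaryShimuraCurveSpecialCurvesIndexed
import Literature.AlgebraicGeometry.ShimuraVarieties.UnitaryShimuraCurveLevelJunction
import Literature.AlgebraicGeometry.ShimuraVarieties.UnitaryShimuraCurveEmbeddingLevels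
import Literature.AlgebraicGeometry.ShimuraVarieties.UnitaryShimuraCurveEmbeddingInjectiveCofinal
import Literature.AlgebraicGeometry.ShimuraVarieties.UnitaryShimuraCurveCompact
import Literature.AlgebraicGeometry.ShimuraVarieties.UnitaryShimuraCurveHeckeHolds
import Literature.AlgebraicGeometry.ShimuraVarieties.UnitaryShimuraCurveEmbeddingHolds
import Literature.AlgebraicGeometry.Limits.SmoothOfRelativeDimensionCofanDescent
import Literature.NumberTheory.Automorphic.IwahoriGL
import HarnessLib

/-!
# The canonical model of the unitary Shimura CURVE built from its embedding into the compact unitary Shimura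
# SURFACE — road (ii) «embedded-curve descent», HEAD GS-3″

Topic `AlgebraicGeometry/ShimuraVarieties`, namespace `…ShimuraVarieties.UnitaryCanonicalModel`.  THEOREMS ONLY (no
definition, no named fact, no instance, no `sorry`).  Cell `hodgecm-mathlib`, road (ii) of the census «GS-3 ⇐ #62» (A-p10 g7,
cut memo `CUT-R2-5-FIELDS`, leaf L3.7 HEAD); books 0 — GS-3″ is a THEOREM modulo the binders listed below, nothing here is
asserted as a fact.  HC_CM is proved only modulo the printed citations of record until rung 0 closes.

SETTING.  A canonical-model record system `R : RecordSystem L H τ T hT K₀′` of the compact unitary Shimura SURFACE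
`Sh(U(H), 𝔹²)` over the CM field `L` (★ `UnitaryShimuraCanonicalModel`), an anisotropic `H`, a rational frame
`ᵗ(cB)·H·B = J⋆ ⊕ J⊥` (the frame scalar PINNED to `a = 1`, as at the consuming face: then the special curves' Gram matrix is
`J⋆^τ` itself, which the `pieces` field of ★ `RecordSystemGS` demands token for token) with `J⋆` `c`-hermitian non-degenerate of
signature `(1,1)` at `τ` (`hTstar`), so that `φGS : u ↦ R_B(u ⊕ 1)` embeds `U(J⋆)(𝔸_{L⁺,f}) ↪ U(H)(𝔸_{L⁺,f})` and
`embPoints : Sh_{K⋆}(U(J⋆), 𝔻)(ℂ) → Sh_K(U(H), 𝔹²)(ℂ) = M_K(ℂ)` (★ `ShimuraSetGS.embPoints`) the Shimura sets.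

THE HEAD `exists_recordSystemGS_of_recordSystem` (GS-3″, THRESHOLD shape).  For a depth `m₀` below which `embPoints` is
injective at all trace pairs (`hm₀` — the conclusion of ★ `ShimuraSetGS.embPoints_injective_of_le_levelB`, [Deligne1971TravauxShimura]
Prop. 1.15) and a curve base level `K₀⋆` under the threshold `φGS(K₀⋆) ≤ K₀′ ∩ K_B((m₀+3)!)` (`hthr`), THERE IS a curve record
`S⋆ : RecordSystemGS L J⋆ τ K₀⋆` (★ `UnitaryShimuraCurveRecord`) with `S⋆.HeckeTranslateDefinedOver`, `S⋆.IsLevelQuotient` and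
`S⋆.EmbeddingDefinedOver R J⊥ B …` — the three conjuncts being ★ theorems for EVERY curve record (★
`RecordSystemGS.heckeTranslateDefinedOver_holds` / `isLevelQuotient_holds` (A-p13), ★ `RecordSystemGS.embeddingDefinedOver_holds`
(A-p14)); the content is the CONSTRUCTION of `S⋆`:
* levels: the monotone trace levels `Tl : SmallLevel K₀⋆ ⥤ SmallLevel (K₀′ ∩ K_B)` with `φGS⁻¹(Tl K⋆) = K⋆` (★
  `exists_smallLevelFunctor_comap_φGS_eq`, [Deligne1971TravauxShimura] Variante 5.9), read in `SmallLevel K₀′`; below the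
  threshold `embPoints` is injective at every trace pair (`hm₀`) and `Sh_{K⋆}(ℂ)` is compact (★ `ShimuraSetGS.compactSpace_of_frame`);
* models: the DESCENDED TOWER `M⋆ ↪ M ∘ Tl` of the Zariski closure of the embedded curve (★ `RecordSystem.exists_descendedTower`,
  [Deligne1971TravauxShimura] Cor. 5.7 + Variante 5.9);
* special curves (leaf L3.3): at every injective trace pair and over the curve's double cosets `r`, closed reduced special curves
  `κ_r : Z_r ↪ X_{q′(r)}` of the surface pieces with disc data `B⋆_r : UnitaryBallUniformisationDatum 1` of Gram matrix `J⋆^τ` and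
  arithmetic level `Γ_{J⋆}(g⋆_r K⋆ g⋆_r⁻¹)`, intertwined with the pieces along the frames `γ_r B` ([KudlaMillson1990] special cycles) —
  ★ `exists_specialCurves_indexed` (A-p10; over ★ `exists_specialCurveDatum_of_subfieldCode′` (A-p11) and the injectivity seam ★
  `mem_lineStab_of_smul_mem_specialBall_of_embPoints_injective`), its level junction fed by ★
  `conj_frame_blockDiag_mem_arithmeticLevel_of_rep` / `exists_mem_arithmeticLevel_eq_conj_frame_blockDiag` (`UnitaryShimuraCurveLevelJunction`,
  [Deligne1971TravauxShimura] Prop. 1.15 case (A) at depth `(m₀+3)! ≥ 3`); the surface pieces are fed in the SUBFIELD-CODE currency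
  (`e_q : L ≃+* (B q).E` over `τ`, `(B q).H = H^{e_q}`, `(B q).Γ = Γ_q^{e_q}`) read out of the pinned pieces `hpin` (the conclusion of the
  Summits-side ★ `HComp.RecordSystem.exists_pieces_fieldRange`, `(B q).E = τ(L)`; read-outs re-proved inline, §1); the cover clauses and
  the image clause are ★ `RecordSystem.pairwise_disjoint_and_iUnion_range_eq_of_specialCurves` / `mem_range_emb_of_pt_mem_closure_of_specialCurves` (A-p10);
* `pts` / `map_pts` / `recip`: ★ `RecordSystem.exists_homeomorph_complexPoints_of_range_eq_closure_embPoints`,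
  `homeomorph_map_transition_eq`, `smul_homeomorph_symm_mk` (leaf L3.4, A-p09);
* `pieces` / `hol`: ★ `exists_cofan_pieces_of_specialCurves` / `exists_unif_differentiableOn_of_cofan_pieces` (leaf L3.6, A-p14);
* `smooth` / `projective`: ★ `Limits.smoothOfRelativeDimension_and_isProjectiveOver_of_closedSubscheme_of_cofan` (leaf L3.5, A-p16)
  on the cofan of special curves (`(B⋆_r).isSmoothProjective`) inside the projective `M_{Tl K⋆}`.

BINDERS OF RECORD (hypothesis form): `hpin` (Summits pin, discharged at the face by ★ `exists_pieces_fieldRange`) and `hm₀`/`hthr`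
(★ F-INJ conclusion at the threshold; hypothesis-free form = ★ `embPoints_injective_of_le_levelB_holds`).  No leaf binder is left:
`hJ`/`hdet`/`hanis`/`hTstar`/`hτ1`/`hpos` are datum facts the face holds.

## References
* [Deligne1979ShimuraVarieties] P. Deligne, *Variétés de Shimura* (1979): 2.1.2–2.1.4, 2.2.5–2.2.6, 2.7.1 (c), Thm. 2.7.20 (a), Cor. 2.7.21.
* [Deligne1971TravauxShimura] P. Deligne, *Travaux de Shimura*, Sém. Bourbaki 389 (1971): Prop. 1.15 p. 132, Cor. 5.7 p. 156, Variante 5.9 p. 157.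
* [Milne2005ShimuraVarieties] J. S. Milne, *Introduction to Shimura varieties* (2005/2017): Lemma 5.13 p. 57, Thm. 5.16 p. 59,
  Def. 12.8 (62) p. 114, Thm. 13.6 p. 118, Thm. 13.7 / Rem. 13.8 p. 119.
* [Liu2021] Y. Liu, *Fourier–Jacobi cycles and arithmetic relative trace formula*, Camb. J. Math. 9 (2021): proof of Thm. 4.15
  (FJcycle.tex l. 2193–2213), Rem. C.2, §D.3 l. 5353–5359.
* [KudlaMillson1990] S. Kudla, J. Millson, *Intersection numbers of cycles on locally symmetric spaces…*, Publ. IHÉS 71 (1990), §2.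
-/

set_option autoImplicit false

noncomputable section

open Function MulAction Topology NumberField IsDedekindDomain CategoryTheory CategoryTheory.Limits Matrix AlgebraicGeometry Set
open scoped Matrix ComplexOrder
open Literature.AlgebraicGeometry.Motives
open Literature.NumberTheory.Automorphic Literature.NumberTheory.Automorphic.UnitaryGroup
open Literature.NumberTheory.Automorphic.ShimuraDissection (CosetSpace)
open Literature.NumberTheory.Automorphic.Liu2021.AppendixC (C5.OpenCompactSubgroup C5.SmallLevel)
open Literature.Geometry.ComplexHyperbolic Literature.Geometry.ComplexHyperbolic.BallModel

namespace Literature.AlgebraicGeometry.ShimuraVarieties.UnitaryCanonicalModel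

variable {L : Type} [Field L] [NumberField L] [IsCMField L] {Jstar : Matrix (Fin 2) (Fin 2) L} {τ : L →+* ℂ}
  {H : Matrix (Fin 3) (Fin 3) L} {T : GL (Fin 3) ℂ} {hT : formCongr (starRingEnd ℂ) T (H.map τ) = BallModel.J}
  {K₀' : C5.OpenCompactSubgroup ↥(finAdelic (↥(maximalRealSubfield L)) L (IsCMField.complexConj L) 3 H)}

/-! ### §1 Plumbing: read-outs of the field pin (copies of the Summits-side one-liners), representatives, levels -/

section ReadOut

variable {p : ℕ} {X : SchemeOver ℂ} (D : UnitaryBallUniformisationDatum p X)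

omit [NumberField L] [IsCMField L] in
/-- A ring isomorphism `L ≃+* D.E` over `τ` exists as soon as `D.E = τ(L)` (copy of the Summits-side read-out, so that this
Literature file imports nothing from `Summits/`). [folklore] -/
private theorem exists_ringEquiv_coe_eq_of_E_eq (h : D.E = τ.fieldRange) :
    ∃ e : L ≃+* ↥D.E, ∀ x : L, ((e x : ↥D.E) : ℂ) = τ x :=
  ⟨τ.rangeRestrictFieldEquiv.trans (RingEquiv.subfieldCongr h.symm), fun _ => rfl⟩

omit [NumberField L] [IsCMField L] in
/-- Gram matrix over the pinned field: `D.Hℂ = Hm^τ` forces `D.H = Hm^e` for `e : L ≃+* D.E` over `τ`. [folklore] -/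
private theorem H_eq_map_ringEquiv_of_Hℂ_eq (e : L ≃+* ↥D.E) (he : ∀ x : L, ((e x : ↥D.E) : ℂ) = τ x)
    {Hm : Matrix (Fin (p + 1)) (Fin (p + 1)) L} (hH : D.Hℂ = Hm.map τ) : D.H = Hm.map e.toRingHom := by
  ext i j
  have h := congrFun (congrFun hH i) j
  change (D.H i j : ℂ) = τ (Hm i j) at h
  rw [h]
  exact (he (Hm i j)).symm

omit [NumberField L] [IsCMField L] in
/-- Group over the pinned field: `τ₁(D.Γ) = τ(Γ′)` forces `D.Γ = Γ′^e` for `e : L ≃+* D.E` over `τ`. [folklore] -/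
private theorem Γ_eq_map_ringEquiv_of_map_eq (e : L ≃+* ↥D.E) (he : ∀ x : L, ((e x : ↥D.E) : ℂ) = τ x)
    {Γ' : Subgroup (GL (Fin (p + 1)) L)}
    (hΓ : D.Γ.map (Matrix.GeneralLinearGroup.map (D.τ₁ : ↥D.E →+* ℂ)) = Γ'.map (Matrix.GeneralLinearGroup.map τ)) :
    D.Γ = Γ'.map (Matrix.GeneralLinearGroup.map e.toRingHom) := by
  have hcomp : (D.E.subtype).comp e.toRingHom = τ := RingHom.ext fun x => he x
  apply Subgroup.map_injective
    (generalLinearGroup_map_injective (D.E.subtype : ↥D.E →+* ℂ) Subtype.val_injective)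
  change D.Γ.map (Matrix.GeneralLinearGroup.map (D.τ₁ : ↥D.E →+* ℂ)) = _
  rw [hΓ, Subgroup.map_map, ← Matrix.GeneralLinearGroup.map_comp, hcomp]

end ReadOut

/-! ### §2 The HEAD: GS-3″ in hypothesis form -/

section Head

variable (R : RecordSystem L H τ T hT K₀')
  (Jperp : Matrix (Fin 1) (Fin 1) L) (B : GL (Fin 3) L)
  (hB : formCongr ((IsCMField.complexConj L : L ≃ₐ[↥(maximalRealSubfield L)] L) : L →+* L) B ((1 : L) • H) =
    finSum 2 1 Jstar Jperp)
  (hτ1 : 0 < (τ 1).re) (hτ1' : (τ 1).im = 0)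

set_option maxHeartbeats 400000 in -- instance-heavy adelic / Shimura-set statement: `whnf`/`isDefEq` time out at the default (as ★ `UnitaryShimuraCurveDescendedTower`)
/-- **GS-3″ — THE CANONICAL MODEL OF THE UNITARY SHIMURA CURVE FROM ITS EMBEDDING INTO THE SURFACE (threshold shape,
hypothesis form, frame scalar `a = 1`).**  See the module docstring for the construction and the binders of record (`hpin`, `hm₀`/`hthr`); every leaf of the road is consumed BY NAME.
[cite: Deligne1979ShimuraVarieties, Thm. 2.7.20 (a), Cor. 2.7.21, 2.2.5–2.2.6, 2.1.2–2.1.4]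
[cite: Deligne1971TravauxShimura, Prop. 1.15 p. 132, Cor. 5.7 p. 156, Variante 5.9 p. 157]
[cite: Milne2005ShimuraVarieties, Lemma 5.13 p. 57, Thm. 5.16 p. 59, Def. 12.8 (62) p. 114, Thm. 13.6 p. 118, Rem. 13.8 p. 119]
[cite: Liu2021, Thm. 4.15 proof (FJcycle.tex l. 2193–2213), §D.3 l. 5353–5359] -/
theorem exists_recordSystemGS_of_recordSystem
    (hJ : (Jstar.map (IsCMField.complexConj L))ᵀ = Jstar) (hdet : IsUnit Jstar.det)
    (hanis : ∀ v : Fin 3 → L, hermForm (cmConjRingHom L) H v v = 0 → v = 0)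
    {Tstar : GL (Fin 2) ℂ} (hTstar : formCongr (starRingEnd ℂ) Tstar (Jstar.map τ) = Matrix.diagonal ![(1 : ℂ), -1])
    -- the injectivity depth (★ `ShimuraSetGS.embPoints_injective_of_le_levelB`) and the curve base level under the threshold
    (m₀ : ℕ)
    (hm₀ : ∀ Tlev : Subgroup ↥(finAdelic (↥(maximalRealSubfield L)) L (IsCMField.complexConj L) 3 H),
      Tlev ≤ ((finCongruenceLevel (↥(maximalRealSubfield L)) L (IsCMField.complexConj L) 3 (finSum 2 1 Jstar Jperp)
        (Ideal.span {(((m₀ + 3).factorial : ℕ) : 𝓞 L)})).map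
          (finAdelicCongr (↥(maximalRealSubfield L)) L (IsCMField.complexConj L) B one_ne_zero hB).toMonoidHom) →
      ∀ (Kstar : Subgroup ↥(finAdelic (↥(maximalRealSubfield L)) L (IsCMField.complexConj L) 2 Jstar))
        (hK : Kstar.map (φGS L Jstar Jperp H B one_ne_zero hB) ≤ Tlev), Tlev.comap (φGS L Jstar Jperp H B one_ne_zero hB) ≤ Kstar →
        Function.Injective (ShimuraSetGS.embPoints L H τ T hT Jstar Jperp B one_ne_zero hB hτ1 hτ1' Kstar Tlev hK))
    (K₀star : C5.OpenCompactSubgroup ↥(finAdelic (↥(maximalRealSubfield L)) L (IsCMField.complexConj L) 2 Jstar))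
    (hthr : K₀star.1 ≤ (K₀'.1 ⊓ (finCongruenceLevel (↥(maximalRealSubfield L)) L (IsCMField.complexConj L) 3 (finSum 2 1 Jstar Jperp)
        (Ideal.span {(((m₀ + 3).factorial : ℕ) : 𝓞 L)})).map
          (finAdelicCongr (↥(maximalRealSubfield L)) L (IsCMField.complexConj L) B one_ne_zero hB).toMonoidHom).comap
        (φGS L Jstar Jperp H B one_ne_zero hB))
    -- the field pin of the surface pieces (Summits-side ★ `HComp.RecordSystem.exists_pieces_fieldRange`, verbatim conclusion)
    (hpin : letI : Algebra L ℂ := τ.toAlgebra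
      ∀ K : C5.SmallLevel K₀',
      ∃ (g : orbitRel.Quotient (rational (↥(maximalRealSubfield L)) L (IsCMField.complexConj L) 3 H)
            (CosetSpace (rationalToFinAdelic (↥(maximalRealSubfield L)) L (IsCMField.complexConj L) 3 H) K.1.1) →
          finAdelic (↥(maximalRealSubfield L)) L (IsCMField.complexConj L) 3 H)
        (_ : ∀ q, Quotient.mk'' (CosetSpace.pt (rationalToFinAdelic _ L _ 3 H) K.1.1 (g q)) = q)
        (X : orbitRel.Quotient (rational (↥(maximalRealSubfield L)) L (IsCMField.complexConj L) 3 H)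
            (CosetSpace (rationalToFinAdelic (↥(maximalRealSubfield L)) L (IsCMField.complexConj L) 3 H) K.1.1) →
          SchemeOver ℂ)
        (ι : ∀ q, X q ⟶ (baseChangeHom τ).obj (R.M.obj K))
        (_ : IsColimit (Cofan.mk ((baseChangeHom τ).obj (R.M.obj K)) ι))
        (Bq : ∀ q, UnitaryBallUniformisationDatum 2 (X q)),
        ∀ q, (Bq q).E = τ.fieldRange ∧ (Bq q).Hℂ = H.map τ ∧
          (Bq q).Γ.map (Matrix.GeneralLinearGroup.map ((Bq q).τ₁ : ↥(Bq q).E →+* ℂ)) =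
            (arithmeticLevel (↥(maximalRealSubfield L)) L (IsCMField.complexConj L) 3 H
              (K.1.1.map (MulAut.conj (g q)).toMonoidHom)).map (Matrix.GeneralLinearGroup.map τ) ∧
          ∀ x : Ball, AlgPoints.map (ι q) ((Bq q).unif ((T : Matrix (Fin 3) (Fin 3) ℂ) *ᵥ BallModel.lift x)) =
            AlgPoints.baseChangeEquiv τ (R.M.obj K) ((R.pts K).symm (ShimuraSet.mk L H τ T hT K.1.1 x (g q))))
    -- the line `J⊥` is positive at `τ` (the special curves' totally positive normal line)
    (hpos : 0 < (τ (Jperp 0 0)).re) :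
    ∃ Sstar : RecordSystemGS L Jstar τ K₀star,
      Sstar.HeckeTranslateDefinedOver ∧ Sstar.IsLevelQuotient ∧ Sstar.EmbeddingDefinedOver R Jperp B one_ne_zero hB hτ1 hτ1' := by
  classical
  letI : Algebra L ℂ := τ.toAlgebra
  /- (0) the `B`-adapted principal level `K_B((m₀+3)!)` and the threshold target `K₀″ = K₀′ ∩ K_B` -/
  set KB : Subgroup ↥(finAdelic (↥(maximalRealSubfield L)) L (IsCMField.complexConj L) 3 H) :=
    (finCongruenceLevel (↥(maximalRealSubfield L)) L (IsCMField.complexConj L) 3 (finSum 2 1 Jstar Jperp)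
        (Ideal.span {(((m₀ + 3).factorial : ℕ) : 𝓞 L)})).map
      (finAdelicCongr (↥(maximalRealSubfield L)) L (IsCMField.complexConj L) B one_ne_zero hB).toMonoidHom with hKB
  have hKBo : IsOpen (KB : Set ↥(finAdelic (↥(maximalRealSubfield L)) L (IsCMField.complexConj L) 3 H)) :=
    isOpen_levelB L H Jstar Jperp B one_ne_zero hB m₀
  have hKBcl : IsClosed (KB : Set ↥(finAdelic (↥(maximalRealSubfield L)) L (IsCMField.complexConj L) 3 H)) :=
    isClosed_levelB L H Jstar Jperp B one_ne_zero hB m₀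
  let K₀'' : C5.OpenCompactSubgroup ↥(finAdelic (↥(maximalRealSubfield L)) L (IsCMField.complexConj L) 3 H) :=
    ⟨K₀'.1 ⊓ KB, K₀'.2.1.inter hKBo, K₀'.2.2.inter_right hKBcl⟩
  have hthr' : K₀star.1.map (φGS L Jstar Jperp H B one_ne_zero hB) ≤ K₀''.1 := Subgroup.map_le_iff_le_comap.mpr hthr
  /- (1) the trace levels, read in `SmallLevel K₀′` -/
  obtain ⟨Tl₀, hTl₀⟩ := exists_smallLevelFunctor_comap_φGS_eq L Jstar Jperp H B one_ne_zero hB K₀'' K₀star hthr'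
  have hK₀''le : K₀''.1 ≤ K₀'.1 := inf_le_left
  have hK₀''KB : K₀''.1 ≤ KB := inf_le_right
  have hincl : Monotone (fun K : C5.SmallLevel K₀'' =>
      (⟨K.1, show K.1.1 ≤ K₀'.1 from le_trans (show K.1.1 ≤ K₀''.1 from K.2) hK₀''le⟩ : C5.SmallLevel K₀')) :=
    fun _ _ h => h
  let Tl : C5.SmallLevel K₀star ⥤ C5.SmallLevel K₀' := Tl₀ ⋙ Monotone.functor hincl
  have htrace : ∀ Ks : C5.SmallLevel K₀star,
      (Tl.obj Ks).1.1.comap (φGS L Jstar Jperp H B one_ne_zero hB) = Ks.1.1 := fun Ks => (hTl₀ Ks).1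
  have hTl : ∀ Ks : C5.SmallLevel K₀star, Ks.1.1.map (φGS L Jstar Jperp H B one_ne_zero hB) ≤ (Tl.obj Ks).1.1 :=
    fun Ks => (hTl₀ Ks).2
  have hTlKB : ∀ Ks : C5.SmallLevel K₀star, (Tl.obj Ks).1.1 ≤ KB := fun Ks =>
    le_trans (show (Tl₀.obj Ks).1.1 ≤ K₀''.1 from (Tl₀.obj Ks).2) hK₀''KB
  /- (2) injectivity of `embPoints` at every trace pair below the threshold; compactness of the curve's Shimura sets -/
  have hinj : ∀ Ks : C5.SmallLevel K₀star, Function.Injective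
      (ShimuraSetGS.embPoints L H τ T hT Jstar Jperp B one_ne_zero hB hτ1 hτ1' Ks.1.1 (Tl.obj Ks).1.1 (hTl Ks)) := fun Ks =>
    hm₀ (Tl.obj Ks).1.1 (hTlKB Ks) Ks.1.1 (hTl Ks) (le_of_eq (htrace Ks))
  haveI hcpt : ∀ Ks : C5.SmallLevel K₀star, CompactSpace (ShimuraSetGS L Jstar τ Ks.1.1) := fun Ks =>
    ShimuraSetGS.compactSpace_of_frame L H τ Jstar Jperp B one_ne_zero hB hanis hTstar Ks.1.1 Ks.1.2.1
  haveI hfin : ∀ Ks : C5.SmallLevel K₀star, Finite (orbitRel.Quotient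
      ↥(rational (↥(maximalRealSubfield L)) L (IsCMField.complexConj L) 2 Jstar)
      (CosetSpace (rationalToFinAdelic (↥(maximalRealSubfield L)) L (IsCMField.complexConj L) 2 Jstar) Ks.1.1)) := fun Ks =>
    finite_shimuraIndex L 2 Jstar (anisotropic_of_frame L H Jstar Jperp B one_ne_zero hB hanis) Ks.1.1 Ks.1.2.1
  /- (3) the descended tower `M⋆ ↪ M ∘ Tl` -/
  obtain ⟨Mstar, ι, hnat, hcl, hred, hrange⟩ := R.exists_descendedTower Jperp B one_ne_zero hB hτ1 hτ1' Tl hTl hJ hdet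
  haveI := hcl
  have hred' : ∀ Ks : C5.SmallLevel K₀star, IsReduced ((Motives.baseChangeHom τ).obj (Mstar.obj Ks)).left := fun Ks =>
    hred Ks
  /- (4) the surface pieces with the field pin, read in subfield-code currency -/
  choose g hg X ιX hcol Bq hBq using hpin
  have hE := fun (K : C5.SmallLevel K₀') q => exists_ringEquiv_coe_eq_of_E_eq (τ := τ) (Bq K q) (hBq K q).1
  choose eq heq using hE
  have hHq : ∀ (K : C5.SmallLevel K₀') q, (Bq K q).H = H.map (eq K q).toRingHom := fun K q =>
    H_eq_map_ringEquiv_of_Hℂ_eq (Bq K q) (eq K q) (heq K q) (hBq K q).2.1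
  have hΓq : ∀ (K : C5.SmallLevel K₀') q, (Bq K q).Γ =
      (arithmeticLevel (↥(maximalRealSubfield L)) L (IsCMField.complexConj L) 3 H
        ((K.1.1).map (MulAut.conj (g K q)).toMonoidHom)).map (Matrix.GeneralLinearGroup.map (eq K q).toRingHom) := fun K q =>
    Γ_eq_map_ringEquiv_of_map_eq (Bq K q) (eq K q) (heq K q) (hBq K q).2.2.1
  have hunifq := fun (K : C5.SmallLevel K₀') q => (hBq K q).2.2.2
  /- (5) the special curves of the surface pieces indexed by the curve's double cosets (★ L3.3 `exists_specialCurves_indexed`,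
  its level junction fed by ★ `conj_frame_blockDiag_mem_arithmeticLevel_of_rep` / `exists_mem_arithmeticLevel_eq_conj_frame_blockDiag`
  at the depth `(m₀+3)! ≥ 3` of the trace pair) -/
  have hJstar : Jstar.det ≠ 0 := hdet.ne_zero
  have hJperp : Jperp.det ≠ 0 := by
    rw [Matrix.det_fin_one]
    intro h
    have h0 := hpos
    rw [h, map_zero, Complex.zero_re] at h0
    exact lt_irrefl _ h0
  have hn : 3 ≤ (m₀ + 3).factorial := (Nat.le_add_left 3 m₀).trans (Nat.self_le_factorial _)
  have h33 := fun Ks : C5.SmallLevel K₀star =>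
    exists_specialCurves_indexed τ hT Jperp B hB hτ1 hτ1' hpos Ks.1.1 (Tl.obj Ks).1.1 (hTl Ks) Ks.1.2.1 Ks.1.2.2 (hinj Ks)
      (fun g₃ g₂ γr hγr _ hγ₁ => conj_frame_blockDiag_mem_arithmeticLevel_of_rep L H Jstar Jperp B one_ne_zero hB (hTl Ks)
        g₃ g₂ γr hγr hγ₁)
      (fun g₃ g₂ γr hγr _ hδ hV => exists_mem_arithmeticLevel_eq_conj_frame_blockDiag L H Jstar Jperp B one_ne_zero hB hJstar
        hJperp hn (hTlKB Ks) (le_of_eq (htrace Ks)) g₃ g₂ γr hγr hδ hV)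
      (Bq (Tl.obj Ks)) (g (Tl.obj Ks)) (hg (Tl.obj Ks)) (eq (Tl.obj Ks)) (heq (Tl.obj Ks)) (hHq (Tl.obj Ks)) (hΓq (Tl.obj Ks))
  choose gs hgs q' γ hγ Z hZred κ hκ Bs hBsH hBsΓ hf using h33
  haveI : ∀ (Ks : C5.SmallLevel K₀star) r, IsReduced (Z Ks r).left := hZred
  haveI : ∀ (Ks : C5.SmallLevel K₀star) r, IsClosedImmersion (κ Ks r).left := hκ
  have hBq' : ∀ (K : C5.SmallLevel K₀') q, (Bq K q).Hℂ = H.map τ := fun K q => (hBq K q).2.1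
  -- representatives exhaust the classes and separate them (★ `CosetSpace.exists_inv_mul_rep_mem_of_mk_pt_eq` / `eq_of_…`)
  have hreps : ∀ (Ks : C5.SmallLevel K₀star) (u : ↥(finAdelic (↥(maximalRealSubfield L)) L (IsCMField.complexConj L) 2 Jstar)),
      ∃ (r : orbitRel.Quotient ↥(rational (↥(maximalRealSubfield L)) L (IsCMField.complexConj L) 2 Jstar)
          (CosetSpace (rationalToFinAdelic (↥(maximalRealSubfield L)) L (IsCMField.complexConj L) 2 Jstar) Ks.1.1))
        (δ : ↥(rational (↥(maximalRealSubfield L)) L (IsCMField.complexConj L) 2 Jstar)),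
        (rationalToFinAdelic (↥(maximalRealSubfield L)) L (IsCMField.complexConj L) 2 Jstar δ * u)⁻¹ * gs Ks r ∈ Ks.1.1 :=
    fun Ks u => CosetSpace.exists_inv_mul_rep_mem_of_mk_pt_eq _ _ (hgs Ks) u
  have hreps' : ∀ (Ks : C5.SmallLevel K₀star) (r r' : orbitRel.Quotient
        ↥(rational (↥(maximalRealSubfield L)) L (IsCMField.complexConj L) 2 Jstar)
        (CosetSpace (rationalToFinAdelic (↥(maximalRealSubfield L)) L (IsCMField.complexConj L) 2 Jstar) Ks.1.1))
      (δ : ↥(rational (↥(maximalRealSubfield L)) L (IsCMField.complexConj L) 2 Jstar)),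
      (rationalToFinAdelic (↥(maximalRealSubfield L)) L (IsCMField.complexConj L) 2 Jstar δ * gs Ks r')⁻¹ * gs Ks r ∈ Ks.1.1 →
        r = r' :=
    fun Ks r r' δ h => CosetSpace.eq_of_inv_mul_rep_mem_of_mk_pt_eq _ _ (hgs Ks) r r' δ h
  /- (6) points: `(M⋆_{K⋆})(ℂ) ≃ₜ Sh_{K⋆}(ℂ)` through `ι` (★ L3.4; the image clause is ★ `mem_range_emb_of_pt_mem_closure_of_specialCurves`
  over the special curves, injectivity is `hm₀` at the trace pair, compactness ★ `compactSpace_of_frame`) -/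
  have himg := fun Ks : C5.SmallLevel K₀star =>
    R.mem_range_emb_of_pt_mem_closure_of_specialCurves Jperp B one_ne_zero hB hτ1 hτ1' (hTl Ks) (ιX (Tl.obj Ks))
      (hcol (Tl.obj Ks)) (Bq (Tl.obj Ks)) (g (Tl.obj Ks)) (hBq' (Tl.obj Ks)) (hunifq (Tl.obj Ks)) (gs Ks) (q' Ks) (γ Ks) (hγ Ks)
      (κ Ks) (Bs Ks) (hBsH Ks) (hf Ks) (hreps Ks)
  have hpts := fun Ks : C5.SmallLevel K₀star =>
    R.exists_homeomorph_complexPoints_of_range_eq_closure_embPoints Jperp B one_ne_zero hB hτ1 hτ1' Ks.1.1 (Tl.obj Ks) (hTl Ks)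
      (ι Ks) (hrange Ks) (himg Ks) (hinj Ks)
  choose e he using hpts
  /- (7) the cofan of lifted special curves and the uniformisation (★ L3.6), the cover clauses being ★
  `pairwise_disjoint_and_iUnion_range_eq_of_specialCurves` at the injective trace pair -/
  have hcover := fun Ks : C5.SmallLevel K₀star =>
    R.pairwise_disjoint_and_iUnion_range_eq_of_specialCurves Jperp B one_ne_zero hB hτ1 hτ1' (hTl Ks) (ιX (Tl.obj Ks))
      (hcol (Tl.obj Ks)) (Bq (Tl.obj Ks)) (g (Tl.obj Ks)) (hBq' (Tl.obj Ks)) (hunifq (Tl.obj Ks)) (gs Ks) (q' Ks) (γ Ks) (hγ Ks)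
      (κ Ks) (Bs Ks) (hBsH Ks) (hf Ks) (hreps Ks) (hreps' Ks) (ι Ks) (hrange Ks) (hinj Ks)
  have hpieces := fun Ks : C5.SmallLevel K₀star =>
    exists_cofan_pieces_of_specialCurves R Jperp B one_ne_zero hB hτ1 hτ1' (hTl Ks) (ιX (Tl.obj Ks)) (hcol (Tl.obj Ks))
      (Bq (Tl.obj Ks)) (g (Tl.obj Ks)) (hBq' (Tl.obj Ks)) (hunifq (Tl.obj Ks)) (gs Ks) (q' Ks) (γ Ks) (hγ Ks)
      (κ Ks) (Bs Ks) (hf Ks) (ι Ks) (hred' Ks) (e Ks) (he Ks) (hcover Ks).1 (hcover Ks).2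
  choose ιs hιs hιscl hcolim hunifs using hpieces
  /- (8) smoothness and projectivity (★ L3.5) -/
  have hSP : ∀ Ks : C5.SmallLevel K₀star,
      SmoothOfRelativeDimension 1 (Mstar.obj Ks).hom ∧ IsProjectiveOver (Mstar.obj Ks) := fun Ks =>
    Literature.AlgebraicGeometry.Limits.smoothOfRelativeDimension_and_isProjectiveOver_of_closedSubscheme_of_cofan τ 1
      (ι Ks) (R.projective (Tl.obj Ks)) (hcolim Ks).some fun r => (Bs Ks r).isSmoothProjective
  /- (9) the record and the three conjuncts (★ u-holds) -/
  let Sstar : RecordSystemGS L Jstar τ K₀star :=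
    { M := Mstar
      smooth := fun Ks => (hSP Ks).1
      projective := fun Ks => (hSP Ks).2
      pts := e
      map_pts := fun Ks Ks' f v hv u =>
        R.homeomorph_map_transition_eq Jperp B one_ne_zero hB hτ1 hτ1' Ks.1.1 Ks'.1.1 (Tl.obj Ks) (Tl.obj Ks') (Tl.map f)
          (hTl Ks) (hTl Ks') (ι Ks) (ι Ks') (Mstar.map f) (hnat f) (e Ks) (he Ks) (e Ks') (he Ks') v hv u
      hol := fun Ks u =>
        exists_unif_differentiableOn_of_cofan_pieces (e Ks) (gs Ks) (hreps Ks) (Bs Ks) (hBsH Ks) (ιs Ks) (hunifs Ks) u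
      pieces := fun Ks =>
        ⟨gs Ks, hgs Ks, Z Ks, ιs Ks, (hcolim Ks).some, Bs Ks, fun r => ⟨hBsH Ks r, hBsΓ Ks r, fun v hv => hunifs Ks r v hv⟩⟩
      recip := fun Ks σ s hs w hw d hd u =>
        R.smul_homeomorph_symm_mk Jperp B one_ne_zero hB hτ1 hτ1' Ks.1.1 (Tl.obj Ks) (hTl Ks) (ι Ks) (e Ks) (he Ks) σ hs hw hd u }
  exact ⟨Sstar, Sstar.heckeTranslateDefinedOver_holds hJ hdet, Sstar.isLevelQuotient_holds hJ hdet,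
    Sstar.embeddingDefinedOver_holds R Jperp B one_ne_zero hB hτ1 hτ1' hJ hdet⟩

end Head

end Literature.AlgebraicGeometry.ShimuraVarieties.UnitaryCanonicalModel

end
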